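import Summits.ValiantsHypothesis.ValiantsHypothesis.Theorems.DivisionGapSquareGridDimersDivisionEasyDecomposition

/-!
# Perfect matchings as fixed-point-free adjacent involutions

The route item encodes a perfect matching of a graph as a fixed-point-free involution `f` on the
vertices with `v` adjacent to `f v`, and weighs it by `∏ v, x_(v, f v)` (both orientations of every
edge).  For an abstract bipartite graph (`a b : β → α` endpoint maps, edges determined by their
endpoints) `sum_invols_eq_sum_pmE` identifies this involution sum with the sum over perfect matchings
`M ⊆ β` of `∏ e ∈ M, x (a e) (b e) * x (b e) (a e)`. [folklore]

All `def … : Prop` declarations in this file are decidable predicates on finite data (not named facts).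
Support file for `SquareGridDimersDivisionEasy` (route DivisionGap, item stmt-ValiantsHypothesis-5072);
the closing theorem is `squareGridDimersDivisionEasy_proof` in `…DivisionGapSquareGridDimersDivisionEasy.lean`.
-/

namespace Summit.ValiantsHypothesis.ValiantsHypothesis.Theorems

namespace SquareGridDimers

set_option linter.dupNamespace false

noncomputable section

open Finset

/-! ## Perfect matchings as fixed-point-free involutions (abstract bridge)

For an abstract bipartite graph with vertex type `α`, edge type `β` and endpoint maps `a b : β → α`
(an edge is determined by its endpoints, and `a`-endpoints are never `b`-endpoints), the sum over
fixed-point-free "adjacent" involutions `f` of `∏ v, x v (f v)` equals the sum over perfect matchings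
`M ⊆ β` of `∏ e ∈ M, x (a e) (b e) * x (b e) (a e)`.  This is the dictionary between the item's
encoding of domino tilings and edge sets. -/

section Bridge

variable {α β : Type*} [Fintype α] [DecidableEq α] [Fintype β] [DecidableEq β]

/-- Adjacency in the abstract graph. [folklore] -/
def AdjE (a b : β → α) (u v : α) : Prop := ∃ e, (a e = u ∧ b e = v) ∨ (a e = v ∧ b e = u)

/-- The item's encoding of perfect matchings: fixed-point-free adjacent involutions. [folklore] -/
def invols (a b : β → α) : Finset (α → α) := by
  classical
  exact univ.filter (fun f => ∀ v, f (f v) = v ∧ f v ≠ v ∧ AdjE a b v (f v))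

/-- The edges of the abstract graph at a vertex, within an edge set. [folklore] -/
def edgesAt (a b : β → α) (M : Finset β) (v : α) : Finset β := M.filter (fun e => a e = v ∨ b e = v)

/-- Perfect matchings of the abstract graph, as edge sets. [folklore] -/
def pmE (a b : β → α) : Finset (Finset β) := univ.filter (fun M => ∀ v, (edgesAt a b M v).card = 1)

/-- The edge set of an involution: the edges `e` with `f (a e) = b e`. [folklore] -/
def edgesOf (a b : β → α) (f : α → α) : Finset β := univ.filter (fun e => f (a e) = b e)

omit [Fintype α] [DecidableEq β] in
/-- Membership in `edgesOf`. [folklore] -/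
@[simp] theorem mem_edgesOf (a b : β → α) (f : α → α) (e : β) :
    e ∈ edgesOf a b f ↔ f (a e) = b e := by
  simp [edgesOf]

omit [DecidableEq β] in
/-- Membership in `pmE`. [folklore] -/
theorem mem_pmE (a b : β → α) (M : Finset β) : M ∈ pmE a b ↔ ∀ v, (edgesAt a b M v).card = 1 := by
  simp [pmE]

variable {a b : β → α}

omit [Fintype α] [DecidableEq β] in
/-- For an adjacent involution, the edges of `edgesOf f` at `v` are exactly one edge, joining `v`
and `f v`. [folklore] -/
theorem edgesAt_edgesOf (hab : ∀ e e', a e ≠ b e') (hinj : ∀ e e', a e = a e' → b e = b e' → e = e')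
    {f : α → α} (hf : ∀ v, f (f v) = v ∧ f v ≠ v ∧ AdjE a b v (f v)) (v : α) :
    ∃ e₀, edgesAt a b (edgesOf a b f) v = {e₀} ∧
      ((a e₀ = v ∧ b e₀ = f v) ∨ (a e₀ = f v ∧ b e₀ = v)) := by
  obtain ⟨e₀, he₀⟩ := (hf v).2.2
  refine ⟨e₀, ?_, he₀⟩
  ext e
  simp only [edgesAt, mem_filter, mem_edgesOf, mem_singleton]
  constructor
  · rintro ⟨hfe, hv⟩
    rcases hv with rfl | rfl <;> rcases he₀ with ⟨h1, h2⟩ | ⟨h1, h2⟩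
    · exact hinj _ _ h1.symm (by rw [h2, hfe])
    · exact absurd h2.symm (hab e e₀)
    · exact absurd h1 (hab e₀ e)
    · refine hinj _ _ ?_ h2.symm
      rw [h1, ← hfe, (hf _).1]
  · rintro rfl
    rcases he₀ with ⟨h1, h2⟩ | ⟨h1, h2⟩
    · exact ⟨by rw [h1, h2], Or.inl h1⟩
    · exact ⟨by rw [h1, h2, (hf v).1], Or.inr h2⟩

omit [DecidableEq β] in
/-- The edge set of an adjacent involution is a perfect matching. [folklore] -/
theorem edgesOf_mem_pmE (hab : ∀ e e', a e ≠ b e') (hinj : ∀ e e', a e = a e' → b e = b e' → e = e')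
    {f : α → α} (hf : ∀ v, f (f v) = v ∧ f v ≠ v ∧ AdjE a b v (f v)) :
    edgesOf a b f ∈ pmE a b := by
  rw [mem_pmE]
  intro v
  obtain ⟨e₀, he₀, -⟩ := edgesAt_edgesOf hab hinj hf v
  rw [he₀, card_singleton]

/-- Distinct edges of a perfect matching have disjoint endpoint pairs. [folklore] -/
theorem pairwiseDisjoint_of_mem_pmE {M : Finset β} (hM : M ∈ pmE a b) :
    (M : Set β).PairwiseDisjoint (fun e => ({a e, b e} : Finset α)) := by
  rw [mem_pmE] at hM
  intro e he e' he' hne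
  rw [Function.onFun, disjoint_left]
  intro v hv hv'
  simp only [mem_insert, mem_singleton] at hv hv'
  have h2 : 2 ≤ (edgesAt a b M v).card := by
    calc 2 = ({e, e'} : Finset β).card := (card_pair hne).symm
      _ ≤ _ := card_le_card (by
          intro x hx
          simp only [mem_insert, mem_singleton] at hx
          simp only [edgesAt, mem_filter]
          rcases hx with rfl | rfl
          · exact ⟨he, by rcases hv with rfl | rfl <;> simp⟩
          · exact ⟨he', by rcases hv' with rfl | rfl <;> simp⟩)
  have := hM v
  omega

omit [DecidableEq β] in
/-- Every vertex is covered by a perfect matching. [folklore] -/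
theorem exists_mem_of_mem_pmE {M : Finset β} (hM : M ∈ pmE a b) (v : α) :
    ∃ e ∈ M, a e = v ∨ b e = v := by
  rw [mem_pmE] at hM
  obtain ⟨e, he⟩ := card_eq_one.mp (hM v)
  have : e ∈ edgesAt a b M v := by rw [he]; exact mem_singleton_self e
  simp only [edgesAt, mem_filter] at this
  exact ⟨e, this.1, this.2⟩

/-- The weight of an adjacent involution is the weight of its edge set. [folklore] -/
theorem prod_eq_prod_edgesOf (hab : ∀ e e', a e ≠ b e')
    (hinj : ∀ e e', a e = a e' → b e = b e' → e = e') {R : Type*} [CommMonoid R] (x : α → α → R)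
    {f : α → α} (hf : ∀ v, f (f v) = v ∧ f v ≠ v ∧ AdjE a b v (f v)) :
    ∏ v, x v (f v) = ∏ e ∈ edgesOf a b f, x (a e) (b e) * x (b e) (a e) := by
  have hpm := edgesOf_mem_pmE hab hinj hf
  have hcover : (univ : Finset α) = (edgesOf a b f).biUnion (fun e => {a e, b e}) := by
    ext v
    simp only [mem_univ, mem_biUnion, mem_insert, mem_singleton, true_iff]
    obtain ⟨e, he, h⟩ := exists_mem_of_mem_pmE hpm v
    exact ⟨e, he, by rcases h with rfl | rfl <;> simp⟩
  rw [hcover, prod_biUnion (pairwiseDisjoint_of_mem_pmE hpm)]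
  refine prod_congr rfl fun e he => ?_
  rw [mem_edgesOf] at he
  have he' : f (b e) = a e := by rw [← he, (hf _).1]
  rw [prod_pair (hab e e), he, he']

omit [Fintype α] [DecidableEq β] in
/-- `edgesOf` is injective on adjacent involutions. [folklore] -/
theorem edgesOf_injective (hab : ∀ e e', a e ≠ b e')
    (hinj : ∀ e e', a e = a e' → b e = b e' → e = e') {f g : α → α}
    (hf : ∀ v, f (f v) = v ∧ f v ≠ v ∧ AdjE a b v (f v))
    (hg : ∀ v, g (g v) = v ∧ g v ≠ v ∧ AdjE a b v (g v)) (h : edgesOf a b f = edgesOf a b g) :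
    f = g := by
  funext v
  obtain ⟨e₀, he₀, hends⟩ := edgesAt_edgesOf hab hinj hf v
  have hmem : e₀ ∈ edgesOf a b g := by
    rw [← h]
    have : e₀ ∈ edgesAt a b (edgesOf a b f) v := by rw [he₀]; exact mem_singleton_self _
    exact (mem_filter.mp this).1
  rw [mem_edgesOf] at hmem
  rcases hends with ⟨h1, h2⟩ | ⟨h1, h2⟩
  · rw [← h2, ← hmem, h1]
  · have hgfv : g (f v) = v := by rw [← h1, hmem, h2]
    have : g v = f v := by
      conv_lhs => rw [← hgfv]
      rw [(hg _).1]
    exact this.symm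

/-- The involution of a perfect matching: send each vertex to the other endpoint of its edge. [folklore] -/
noncomputable def involOf (a b : β → α) (M : Finset β) (v : α) : α := by
  classical
  exact if h : ∃ e ∈ M, a e = v ∨ b e = v then
    (if a h.choose = v then b h.choose else a h.choose) else v

omit [DecidableEq β] in
/-- The defining property of `involOf`. [folklore] -/
theorem involOf_spec (hab : ∀ e e', a e ≠ b e') {M : Finset β} (hM : M ∈ pmE a b) (v : α) :
    ∃ e ∈ M, (a e = v ∧ involOf a b M v = b e) ∨ (b e = v ∧ involOf a b M v = a e) := by
  classical
  have h : ∃ e ∈ M, a e = v ∨ b e = v := exists_mem_of_mem_pmE hM v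
  refine ⟨h.choose, h.choose_spec.1, ?_⟩
  unfold involOf
  rw [dif_pos h]
  rcases h.choose_spec.2 with h1 | h1
  · left; exact ⟨h1, by rw [if_pos h1]⟩
  · right; refine ⟨h1, ?_⟩
    rw [if_neg]
    intro h2
    exact hab _ _ (h2.trans h1.symm)

omit [DecidableEq β] in
/-- Uniqueness of the edge of a perfect matching at a vertex. [folklore] -/
theorem eq_of_mem_pmE {M : Finset β} (hM : M ∈ pmE a b) {v : α} {e e' : β} (he : e ∈ M)
    (he' : e' ∈ M) (hv : a e = v ∨ b e = v) (hv' : a e' = v ∨ b e' = v) : e = e' := by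
  rw [mem_pmE] at hM
  obtain ⟨e₀, he₀⟩ := card_eq_one.mp (hM v)
  have h1 : e ∈ edgesAt a b M v := by simp only [edgesAt, mem_filter]; exact ⟨he, hv⟩
  have h2 : e' ∈ edgesAt a b M v := by simp only [edgesAt, mem_filter]; exact ⟨he', hv'⟩
  rw [he₀, mem_singleton] at h1 h2
  rw [h1, h2]

omit [DecidableEq β] in
/-- The involution of a perfect matching is a fixed-point-free adjacent involution. [folklore] -/
theorem involOf_mem (hab : ∀ e e', a e ≠ b e') {M : Finset β} (hM : M ∈ pmE a b) (v : α) :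
    involOf a b M (involOf a b M v) = v ∧ involOf a b M v ≠ v ∧ AdjE a b v (involOf a b M v) := by
  obtain ⟨e, he, h⟩ := involOf_spec hab hM v
  refine ⟨?_, ?_, ?_⟩
  · obtain ⟨e', he', h'⟩ := involOf_spec hab hM (involOf a b M v)
    rcases h with ⟨h1, h2⟩ | ⟨h1, h2⟩ <;> rcases h' with ⟨h1', h2'⟩ | ⟨h1', h2'⟩
    · exact absurd (h1'.trans h2) (hab e' e)
    · have := eq_of_mem_pmE hM he he' (Or.inr h2.symm) (Or.inr h1')
      subst this; rw [h2', h1]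
    · have := eq_of_mem_pmE hM he he' (Or.inl h2.symm) (Or.inl h1')
      subst this; rw [h2', h1]
    · exact absurd (h2.symm.trans h1'.symm) (hab e e')
  · rcases h with ⟨h1, h2⟩ | ⟨h1, h2⟩
    · rw [h2, ← h1]; exact (hab e e).symm
    · rw [h2, ← h1]; exact hab e e
  · rcases h with ⟨h1, h2⟩ | ⟨h1, h2⟩
    · exact ⟨e, Or.inl ⟨h1, h2.symm⟩⟩
    · exact ⟨e, Or.inr ⟨h2.symm, h1⟩⟩

omit [DecidableEq β] in
/-- The edge set of the involution of a perfect matching is the matching. [folklore] -/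
theorem edgesOf_involOf (hab : ∀ e e', a e ≠ b e')
    (hinj : ∀ e e', a e = a e' → b e = b e' → e = e') {M : Finset β} (hM : M ∈ pmE a b) :
    edgesOf a b (involOf a b M) = M := by
  ext e
  rw [mem_edgesOf]
  obtain ⟨e', he', h⟩ := involOf_spec hab hM (a e)
  constructor
  · intro hfe
    rcases h with ⟨h1, h2⟩ | ⟨h1, h2⟩
    · rw [hinj e e' h1.symm (hfe.symm.trans h2)]; exact he'
    · exact absurd h1.symm (hab e e')
  · intro he
    rcases h with ⟨h1, h2⟩ | ⟨h1, h2⟩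
    · rw [h2, eq_of_mem_pmE hM he he' (Or.inl rfl) (Or.inl h1)]
    · exact absurd h1.symm (hab e e')

/-- **Bridge.** The item's involution sum equals the edge-set sum over perfect matchings. [folklore] -/
theorem sum_invols_eq_sum_pmE (hab : ∀ e e', a e ≠ b e')
    (hinj : ∀ e e', a e = a e' → b e = b e' → e = e') {R : Type*} [CommSemiring R]
    (x : α → α → R) :
    ∑ f ∈ invols a b, ∏ v, x v (f v) = ∑ M ∈ pmE a b, ∏ e ∈ M, x (a e) (b e) * x (b e) (a e) := by
  have hmem : ∀ f, f ∈ invols a b ↔ ∀ v, f (f v) = v ∧ f v ≠ v ∧ AdjE a b v (f v) := fun f => by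
    simp [invols]
  refine sum_bij (fun f _ => edgesOf a b f) ?_ ?_ ?_ ?_
  · intro f hf; exact edgesOf_mem_pmE hab hinj ((hmem f).mp hf)
  · intro f hf g hg h; exact edgesOf_injective hab hinj ((hmem f).mp hf) ((hmem g).mp hg) h
  · intro M hM
    exact ⟨involOf a b M, (hmem _).mpr (involOf_mem hab hM), edgesOf_involOf hab hinj hM⟩
  · intro f hf; exact prod_eq_prod_edgesOf hab hinj x ((hmem f).mp hf)

end Bridge

end

end SquareGridDimers

end Summit.ValiantsHypothesis.ValiantsHypothesis.Theorems
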